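import Mathlib

/-!
# Orbit designs for `ThinPackings`: the Fourier counting identity (F1)

Line `automorphism-orbit-twisted-templates` (skeleton `Ideator4Sketch`) of crux
`ThinBlockAlpha.ThinPackings` (stmt-MatrixMultiplication-10595), stub `stub_charCount`.

For finsets `X, Y, Z` in a finite abelian group `H`, summing the product of the three character
sums over ALL characters `ψ : AddChar H ℂ` counts the solutions of `x + y + z = 0`:
`∑_ψ X̂(ψ) Ŷ(ψ) Ẑ(ψ) = |H| · #{((x, y), z) ∈ (X ×ˢ Y) ×ˢ Z : x + y + z = 0}`.

Proof: expand the triple product, use `ψ x * ψ y * ψ z = ψ (x + y + z)`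
(`AddChar.map_add_eq_mul`), swap the sum over `ψ` inside (`Finset.sum_comm`) and apply the
orthogonality relation `AddChar.sum_apply_eq_ite`; the remaining indicator sum is the cardinality
of the filtered product (`Finset.card_filter`, `Finset.sum_product`).  Mathlib only.
-/

set_option linter.dupNamespace false  -- `Summit.<S>.<S>.…` is the mandated namespace

namespace Summit.MatrixMultiplication.MatrixMultiplication.Theorems.ThinPackings.Orbit

open Finset

/-- Expanding the product of three character sums: `X̂(ψ) Ŷ(ψ) Ẑ(ψ) = ∑_{x,y,z} ψ (x + y + z)`. -/
theorem charSum_mul_charSum_mul_charSum {H : Type} [AddCommGroup H] (ψ : AddChar H ℂ)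
    (X Y Z : Finset H) :
    (∑ x ∈ X, ψ x) * (∑ y ∈ Y, ψ y) * (∑ z ∈ Z, ψ z)
      = ∑ x ∈ X, ∑ y ∈ Y, ∑ z ∈ Z, ψ (x + y + z) := by
  rw [Finset.sum_mul_sum, Finset.sum_mul]
  refine Finset.sum_congr rfl fun x _ => ?_
  rw [Finset.sum_mul]
  refine Finset.sum_congr rfl fun y _ => ?_
  rw [Finset.mul_sum]
  refine Finset.sum_congr rfl fun z _ => ?_
  rw [AddChar.map_add_eq_mul, AddChar.map_add_eq_mul]

/-- The iterated indicator sum of `x + y + z = 0` over `X, Y, Z` is the number of solutions in the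
product finset `(X ×ˢ Y) ×ˢ Z`. -/
theorem sum_sum_sum_ite_eq_card_filter {H : Type} [AddCommGroup H] [DecidableEq H]
    (X Y Z : Finset H) :
    (∑ x ∈ X, ∑ y ∈ Y, ∑ z ∈ Z, if x + y + z = 0 then 1 else 0)
      = (((X ×ˢ Y) ×ˢ Z).filter fun t => t.1.1 + t.1.2 + t.2 = 0).card := by
  rw [Finset.card_filter, Finset.sum_product, Finset.sum_product]

/-- **(F1) Fourier counting identity.**  For finsets `X, Y, Z` of a finite abelian group `H`,
`∑_ψ X̂(ψ) Ŷ(ψ) Ẑ(ψ) = |H| · #{((x, y), z) ∈ (X ×ˢ Y) ×ˢ Z : x + y + z = 0}`, the sum ranging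
over all characters `ψ : AddChar H ℂ` (orthogonality `AddChar.sum_apply_eq_ite`). [folklore] -/
theorem stub_charCount : ∀ {H : Type} [AddCommGroup H] [Fintype H] [DecidableEq H] (X Y Z : Finset H), ∑ ψ : AddChar H ℂ, (∑ x ∈ X, ψ x) * (∑ y ∈ Y, ψ y) * (∑ z ∈ Z, ψ z) = (Fintype.card H : ℂ) * ((((X ×ˢ Y) ×ˢ Z).filter fun t => t.1.1 + t.1.2 + t.2 = 0).card : ℂ) := by
  intro H _ _ _ X Y Z
  simp_rw [charSum_mul_charSum_mul_charSum]
  rw [Finset.sum_comm]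
  simp_rw [Finset.sum_comm (s := (Finset.univ : Finset (AddChar H ℂ))) (t := Y),
    Finset.sum_comm (s := (Finset.univ : Finset (AddChar H ℂ))) (t := Z),
    AddChar.sum_apply_eq_ite]
  rw [← sum_sum_sum_ite_eq_card_filter]
  push_cast
  rw [Finset.mul_sum]
  refine Finset.sum_congr rfl fun x _ => ?_
  rw [Finset.mul_sum]
  refine Finset.sum_congr rfl fun y _ => ?_
  rw [Finset.mul_sum]
  refine Finset.sum_congr rfl fun z _ => ?_
  split_ifs <;> simp

end Summit.MatrixMultiplication.MatrixMultiplication.Theorems.ThinPackings.Orbit
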